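import Mathlib
import Summits.CriticalPhenomena.PercolationContinuityZ3.Theorems.PercNearOneGluingNearOneGluingKnLemma3i
import Literature.Probability.LatticeModels.ProdBernoulliIndependence
import Literature.Probability.Percolation.PercolationEvents
import Literature.Probability.Percolation.Crossings
import HarnessLib

/-!
# Crux `PercNearOneGluing.NearOneGluing` (stmt-CriticalPhenomena-4574), line `SketchR2I5` — stub `stub_maxattTwo`

Helper file for the crux (lead prover-line-stmt-CriticalPhenomena-4574-c4, cycle 4): the
**two-relay case, at arbitrary depth, of the MAXATT / least-reliable-first gluing inequality**.
Proves exactly the registered stub signature; lands with `--supports stmt-CriticalPhenomena-4574`.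

## Content

Finite weighted graph on `Fin n`, `μ = prodBernoulli w`, target `b`, source `o`, two relays `x, y` with
`μ(y ↔ b) ≤ μ(x ↔ b)` (`y` is the less reliable one).  Attachment events
`X = {o ↔ x inside {v | v ≠ b ∧ v ≠ y}}` and `Y = {o ↔ y inside {v | v ≠ b ∧ v ≠ x}}` (the relay is
reached from `o` by an open path avoiding `b` and the other relay, i.e. it is attached to the
relay-free pocket of `o`).  THEOREM (`stub_maxattTwo`):

`μ(o ↮ b, X ∪ Y) ≤ μ(y ↮ b) · μ(Y) + μ(x ↮ b) · μ(X ∖ Y)`,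

i.e. the bad event is paid by the unreliability of the LEAST reliable attached relay.  At depth one
(`o` adjacent to relays only) this is the landed `stub_lrfDepthOneTwo`; here the depth is arbitrary.

Proof.  On `X`, `x ↔ o`, so `o ↔ b ⟺ x ↔ b`; on `Y`, `o ↔ b ⟺ y ↔ b`; hence
`μ(o ↔ b, X ∪ Y) = μ(x ↔ b, X ∖ Y) + μ(y ↔ b, Y)` and `μ(x ↔ b, X ∩ Y) = μ(y ↔ b, X ∩ Y)`.
Harris (`{x ↔ b}` and `X ∪ Y` increasing): `μ(x ↔ b, X ∪ Y) ≥ μ(x ↔ b) μ(X ∪ Y)`.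
Kozma–Nitzan Lemma 3(i) (landed `knLemma3i`, from BHK 2006) with `a₁ = x`, `a₂ = y`,
`d = μ(x ↔ b) − μ(y ↔ b) ≥ 0` and `Q = Y`, which is increasing in the open edge cluster of `y`
(`maxattTwo_openConnIn_mono_openEdgeCluster`): `μ(x ↔ b, Y) ≤ μ(y ↔ b, Y) + d μ(Y)`.  Hence
`μ(o ↔ b, X ∪ Y) = μ(x ↔ b, X ∪ Y) − μ(x ↔ b, Y) + μ(y ↔ b, Y) ≥ μ(x ↔ b) μ(X ∪ Y) − d μ(Y)`, and
`μ(o ↮ b, X ∪ Y) = μ(X ∪ Y) − μ(o ↔ b, X ∪ Y) ≤ (1 − μ(x↔b)) μ(X ∪ Y) + d μ(Y)`, which is the claim since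
`μ(X ∪ Y) = μ(Y) + μ(X ∖ Y)`.
-/

namespace Summit.CriticalPhenomena.PercolationContinuityZ3.Theorems

open MeasureTheory Set Literature.Probability.LatticeModels Literature.Probability.Percolation
open scoped Classical BigOperators

section MaxattTwo

variable {V : Type*}

/-- A restricted connection `{x ↔ y in S}` implies the plain connection `{x ↔ y}`. [folklore] -/
theorem maxattTwo_openConn_of_openConnIn {S : Set V} {x y : V} {ω : BondConfig V}
    (h : ω ∈ openConnIn S x y) : ω ∈ (openConn x y : Set (BondConfig V)) := by
  obtain ⟨hx, hy, hr⟩ := h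
  exact hr.map (SimpleGraph.Embedding.induce _).toHom

/-- **`{o ↔ y in S}` is increasing in the open edge cluster of `y`** (hypothesis shape of
`knLemma3i`): every edge of an open `o–y` path inside `S` is an open non-loop edge both of whose
endpoints are joined to `y`, hence lies in `C_y`; so the same path is open in any configuration whose
edge cluster of `y` is larger. [cite: VandenbergHaggstromKahn2005, §1 p. 3] -/
theorem maxattTwo_openConnIn_mono_openEdgeCluster (S : Set V) (o y : V) :
    ∀ ω ω' : BondConfig V, ω ∈ (openConnIn S o y : Set (BondConfig V)) →
      openEdgeCluster ω y ⊆ openEdgeCluster ω' y → ω' ∈ (openConnIn S o y : Set (BondConfig V)) := by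
  intro ω ω' hω hsub
  obtain ⟨ho, hy, hr⟩ := hω
  refine ⟨ho, hy, ?_⟩
  -- walk from `o` to `y` in the induced open graph of `ω`; transfer it edge by edge
  obtain ⟨p⟩ := hr
  -- claim for walks ending at `y`
  suffices h : ∀ (u v : S) (q : ((openGraph ω).induce S).Walk u v), v = ⟨y, hy⟩ →
      ((openGraph ω').induce S).Reachable u v ∧ (openGraph ω).Reachable y u.1 from
    (h ⟨o, ho⟩ ⟨y, hy⟩ p rfl).1
  intro u v q
  induction q with
  | nil =>
    intro hv
    subst hv
    exact ⟨SimpleGraph.Reachable.refl _, SimpleGraph.Reachable.refl _⟩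
  | cons hadj q ih =>
    intro hv
    rename_i u v _
    obtain ⟨ih1, ih2⟩ := ih hv
    have hadj' : (openGraph ω).Adj u.1 v.1 := hadj
    have huv := (openGraph_adj ω u.1 v.1).1 hadj'
    have hyu : (openGraph ω).Reachable y u.1 := ih2.trans hadj'.symm.reachable
    have hmem : s(u.1, v.1) ∈ openEdgeCluster ω y := by
      refine (mem_openEdgeCluster_iff ω y _).2 ⟨huv.1, ?_, ?_⟩
      · rw [Sym2.mk_isDiag_iff]; exact huv.2
      · intro z hz
        rcases Sym2.mem_iff.1 hz with rfl | rfl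
        · exact hyu
        · exact ih2
    have hmem' : s(u.1, v.1) ∈ ω' := openEdgeCluster_subset ω' y (hsub hmem)
    have hadj'' : ((openGraph ω').induce S).Adj u v := by
      show (openGraph ω').Adj u.1 v.1
      exact (openGraph_adj ω' u.1 v.1).2 ⟨hmem', huv.2⟩
    exact ⟨hadj''.reachable.trans ih1, hyu⟩

end MaxattTwo

/-- **MAXATT for two relays at arbitrary depth** (least-reliable-first gluing inequality, `|A| = 2`):
with `X = {o ↔ x inside {v ≠ b, v ≠ y}}`, `Y = {o ↔ y inside {v ≠ b, v ≠ x}}` and `μ(y ↔ b) ≤ μ(x ↔ b)`,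
`μ(o ↮ b, X ∪ Y) ≤ μ(y ↮ b)·μ(Y) + μ(x ↮ b)·μ(X ∖ Y)`.  Harris + Kozma–Nitzan Lemma 3(i) (`knLemma3i`). -/
theorem stub_maxattTwo :
    ∀ (n : ℕ) (w : Sym2 (Fin n) → unitInterval) (o b x y : Fin n),
      (prodBernoulli w).real (openConn y b) ≤ (prodBernoulli w).real (openConn x b) →
      (prodBernoulli w).real {ω | ω ∉ openConn o b ∧
          (ω ∈ openConnIn {v : Fin n | v ≠ b ∧ v ≠ y} o x ∨ ω ∈ openConnIn {v : Fin n | v ≠ b ∧ v ≠ x} o y)} ≤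
        (prodBernoulli w).real (openConn y b)ᶜ *
            (prodBernoulli w).real (openConnIn {v : Fin n | v ≠ b ∧ v ≠ x} o y) +
          (prodBernoulli w).real (openConn x b)ᶜ *
            (prodBernoulli w).real
              (openConnIn {v : Fin n | v ≠ b ∧ v ≠ y} o x \ openConnIn {v : Fin n | v ≠ b ∧ v ≠ x} o y) := by
  intro n w o b x y hle
  -- notation
  set μ := prodBernoulli w with hμ
  set X : Set (BondConfig (Fin n)) := openConnIn {v : Fin n | v ≠ b ∧ v ≠ y} o x with hX
  set Y : Set (BondConfig (Fin n)) := openConnIn {v : Fin n | v ≠ b ∧ v ≠ x} o y with hY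
  set Bx : Set (BondConfig (Fin n)) := openConn x b with hBx
  set By : Set (BondConfig (Fin n)) := openConn y b with hBy
  set Bo : Set (BondConfig (Fin n)) := openConn o b with hBo
  have hm : ∀ s : Set (BondConfig (Fin n)), MeasurableSet s := fun s => MeasurableSet.of_discrete
  -- pointwise facts
  have hXo : ∀ ω ∈ X, (ω ∈ Bo ↔ ω ∈ Bx) := by
    intro ω hω
    have hox : (openGraph ω).Reachable o x := maxattTwo_openConn_of_openConnIn hω
    exact ⟨fun h => hox.symm.trans h, fun h => hox.trans h⟩
  have hYo : ∀ ω ∈ Y, (ω ∈ Bo ↔ ω ∈ By) := by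
    intro ω hω
    have hoy : (openGraph ω).Reachable o y := maxattTwo_openConn_of_openConnIn hω
    exact ⟨fun h => hoy.symm.trans h, fun h => hoy.trans h⟩
  -- measure identities
  have hXY : μ.real (X ∪ Y) = μ.real Y + μ.real (X \ Y) := by
    rw [← measureReal_union (Set.disjoint_sdiff_right) (hm _), Set.union_sdiff_self, Set.union_comm]
  have hbad : μ.real {ω | ω ∉ Bo ∧ (ω ∈ X ∨ ω ∈ Y)} = μ.real (X ∪ Y) - μ.real (Bo ∩ (X ∪ Y)) := by
    have h1 : {ω | ω ∉ Bo ∧ (ω ∈ X ∨ ω ∈ Y)} = (X ∪ Y) \ (Bo ∩ (X ∪ Y)) := by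
      ext ω; simp only [Set.mem_setOf_eq, Set.mem_sdiff, Set.mem_union, Set.mem_inter_iff]; tauto
    rw [h1, measureReal_sdiff (Set.inter_subset_right) (hm _)]
  have hgood : μ.real (Bo ∩ (X ∪ Y)) = μ.real (Bx ∩ (X \ Y)) + μ.real (By ∩ Y) := by
    have h1 : Bo ∩ (X ∪ Y) = (Bx ∩ (X \ Y)) ∪ (By ∩ Y) := by
      ext ω
      simp only [Set.mem_inter_iff, Set.mem_union, Set.mem_sdiff]
      constructor
      · rintro ⟨hb, hx | hy⟩
        · by_cases hy : ω ∈ Y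
          · exact Or.inr ⟨(hYo ω hy).1 hb, hy⟩
          · exact Or.inl ⟨(hXo ω hx).1 hb, hx, hy⟩
        · exact Or.inr ⟨(hYo ω hy).1 hb, hy⟩
      · rintro (⟨hb, hx, -⟩ | ⟨hb, hy⟩)
        · exact ⟨(hXo ω hx).2 hb, Or.inl hx⟩
        · exact ⟨(hYo ω hy).2 hb, Or.inr hy⟩
    rw [h1, measureReal_union _ (hm _)]
    exact Set.disjoint_left.2 fun ω h1 h2 => h1.2.2 h2.2
  have hxsplit : μ.real (Bx ∩ (X ∪ Y)) = μ.real (Bx ∩ (X \ Y)) + μ.real (Bx ∩ Y) := by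
    have h1 : Bx ∩ (X ∪ Y) = (Bx ∩ (X \ Y)) ∪ (Bx ∩ Y) := by
      ext ω; simp only [Set.mem_inter_iff, Set.mem_union, Set.mem_sdiff]; tauto
    rw [h1, measureReal_union _ (hm _)]
    exact Set.disjoint_left.2 fun ω h1 h2 => h1.2.2 h2.2
  -- Harris for `{x ↔ b}` and `X ∪ Y`
  have hharris : μ.real Bx * μ.real (X ∪ Y) ≤ μ.real (Bx ∩ (X ∪ Y)) :=
    prodBernoulli_harris w (isUpperSet_openConn x b)
      ((isUpperSet_openConnIn _ o x).union (isUpperSet_openConnIn _ o y)) (hm _) (hm _)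
  -- Kozma–Nitzan Lemma 3(i) with `Q = Y`
  have hkn : μ.real (Bx ∩ Y) ≤ μ.real (By ∩ Y) + (μ.real Bx - μ.real By) * μ.real Y :=
    knLemma3i n w x y b Y (μ.real Bx - μ.real By)
      (maxattTwo_openConnIn_mono_openEdgeCluster _ o y) (sub_nonneg.2 hle) (by linarith)
  -- complements
  have hcx : μ.real Bxᶜ = 1 - μ.real Bx := probReal_compl_eq_one_sub (hm _)
  have hcy : μ.real Byᶜ = 1 - μ.real By := probReal_compl_eq_one_sub (hm _)
  rw [hbad, hcx, hcy, hgood]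
  rw [hXY] at hharris ⊢
  have e1 : μ.real Bx * (μ.real Y + μ.real (X \ Y)) = μ.real Bx * μ.real Y + μ.real Bx * μ.real (X \ Y) := by
    ring
  have e2 : (μ.real Bx - μ.real By) * μ.real Y = μ.real Bx * μ.real Y - μ.real By * μ.real Y := by ring
  have e3 : (1 - μ.real By) * μ.real Y = μ.real Y - μ.real By * μ.real Y := by ring
  have e4 : (1 - μ.real Bx) * μ.real (X \ Y) = μ.real (X \ Y) - μ.real Bx * μ.real (X \ Y) := by ring
  rw [e3, e4]
  rw [e1] at hharris
  rw [e2] at hkn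
  linarith [hharris, hkn, hxsplit]

end Summit.CriticalPhenomena.PercolationContinuityZ3.Theorems
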